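import Summits.BirchSwinnertonDyer.BirchSwinnertonDyer.Theorems.UniversalToricDescentInvariantsTransportNormProfileFrames
import Summits.BirchSwinnertonDyer.BirchSwinnertonDyer.Theorems.UniversalToricDescentToricTransportModThreeStubRatSqueeze
import Summits.BirchSwinnertonDyer.BirchSwinnertonDyer.Theorems.UniversalToricDescentToricTransportModThreeFlatGlue
import Summits.BirchSwinnertonDyer.BirchSwinnertonDyer.Theorems.UniversalToricDescentSelfMuZeroAtThree
import HarnessLib

/-!
# The RATIONAL cross-squeeze in `R₀⟦T⟧` (LEAD bsd-wall-utd-p1 g19, 2026-08-29; helper for the UTD parent node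
# stmt-BirchSwinnertonDyer-20186 `ToricTransportModThree`, line `ratwall_thin_comb`)

Pure algebra in `R₀⟦T⟧ = UnrSeries 3`. The parent's equality `Ch_Λ(X_E)·R₀⟦T⟧ = (𝓛)` from FOUR one-sided pieces, none of which is
the integral wall: (i) a RATIONAL wall `3^k·𝓛 ∈ (g)` (line `ratwall_thin_comb`: `stub_ratCombSupply` + `stub_ratDescent` ✓);
(ii) norm profiles `(0, n)`, `(0, m)`, `(0, n′)`, `(0, m′)` of `g, 𝓛, g′, 𝓛′` with the ONE-SIDED transport inequality
`n′ + m ≤ n + m′` (the conclusion of ♭T≤ `DefectTransportModThreePT`, wall-free by `…DefectTransportModThreePTWallFree`);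
(iii) the twin main conjecture `(g′) = (𝓛′)`. Then `n′ = m′` (associates share their profile), so `m ≤ n`; `μ(g) = 0` peels the
`3`'s off the rational wall (`stub_ratSqueeze`'s lemmas) so `g ∣ 𝓛`, whence `n ≤ m` (low coefficients of a multiple of `g` are
small); `n = m` and the norm-profile squeeze give `(g) = (𝓛)`.

Tree lemmas reused by name: `UniversalToricDescentSelfMuZero.normProfile_unique` (profile index unique),
`UniversalToricDescentActDFlatGlue.firstUnitCoeff_le_of_dvd` (`g ∣ L` ⟹ `λ(g) ≤ λ(L)`), `normProfile_iff_of_span_singleton_eq`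
(associates share their profile), `RatwallThinComb.dvd_of_dvd_prime_pow_mul` / `prime_C_three` / `not_C_three_dvd_of_norm_coeff_eq_one`
(peeling the `3`'s), `span_eq_span_of_dvd_of_normProfile` (the squeeze).
* `span_eq_span_of_rationalWall` — the rational cross-squeeze: `(g) = (𝓛) ∧ n = m`.
* `eq_span_of_rationalWall` — the same for an ideal `I = (g)` (the parent's `Ch·R₀⟦T⟧`).

THEOREMS ONLY; no `sorry`. BSD is not proved by any of this. References: [Washington1997] §7.1; folklore.
-/

set_option linter.dupNamespace false
set_option autoImplicit false

noncomputable section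

open Literature.NumberTheory.EllipticCurves
open Summit.BirchSwinnertonDyer.BirchSwinnertonDyer.Theorems.UniversalToricDescentNormProfile
open Summit.BirchSwinnertonDyer.BirchSwinnertonDyer.Cruxes.ToricTransportModThree.RatwallThinComb

namespace Summit.BirchSwinnertonDyer.BirchSwinnertonDyer.Theorems.UniversalToricDescentRationalCrossSqueeze

/-- **The rational cross-squeeze.** `g, L, g′, L′ ∈ R₀⟦T⟧` with norm profiles `(0,n), (0,m), (0,n′), (0,m′)`, the twin equality
`(g′) = (L′)`, the one-sided transport `n′ + m ≤ n + m′`, and the RATIONAL wall `3^k·L ∈ (g)` give `(g) = (L)` and `n = m`.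
[cite: Washington1997, §7.1] [cite: GreenbergVatsal2000, Thm. (1.4) (the cross-squeeze it feeds)] -/
theorem span_eq_span_of_rationalWall {g L g' L' : UnrSeries 3} {n m n' m' k : ℕ}
    (hg : (∀ i < n, ‖((PowerSeries.coeff i g : unrIntegers 3) : ℂ_[3])‖ < 1) ∧
      ‖((PowerSeries.coeff n g : unrIntegers 3) : ℂ_[3])‖ = 1)
    (hL : (∀ i < m, ‖((PowerSeries.coeff i L : unrIntegers 3) : ℂ_[3])‖ < 1) ∧
      ‖((PowerSeries.coeff m L : unrIntegers 3) : ℂ_[3])‖ = 1)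
    (hg' : (∀ i < n', ‖((PowerSeries.coeff i g' : unrIntegers 3) : ℂ_[3])‖ < 1) ∧
      ‖((PowerSeries.coeff n' g' : unrIntegers 3) : ℂ_[3])‖ = 1)
    (hL' : (∀ i < m', ‖((PowerSeries.coeff i L' : unrIntegers 3) : ℂ_[3])‖ < 1) ∧
      ‖((PowerSeries.coeff m' L' : unrIntegers 3) : ℂ_[3])‖ = 1)
    (htwin : Ideal.span ({g'} : Set (UnrSeries 3)) = Ideal.span {L'}) (hle : n' + m ≤ n + m')
    (hmem : ((3 : ℕ) : UnrSeries 3) ^ k * L ∈ Ideal.span ({g} : Set (UnrSeries 3))) :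
    Ideal.span ({g} : Set (UnrSeries 3)) = Ideal.span {L} ∧ n = m := by
  -- the twin: associates share their profile, so `n′ = m′` and `m ≤ n`
  have hn'm' : n' = m' :=
    UniversalToricDescentSelfMuZero.normProfile_unique ((normProfile_iff_of_span_singleton_eq htwin n').mp hg') hL'
  have hmn : m ≤ n := by omega
  -- the rational wall with `μ(g) = 0`: `g ∣ L`, so `n ≤ m`
  have hgdvd : g ∣ ((3 : ℕ) : UnrSeries 3) ^ k * L := Ideal.mem_span_singleton.mp hmem
  rw [← map_natCast (PowerSeries.C (R := unrIntegers 3))] at hgdvd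
  have hdvd : g ∣ L := dvd_of_dvd_prime_pow_mul prime_C_three (not_C_three_dvd_of_norm_coeff_eq_one hg.2) k hgdvd
  have hnm : n ≤ m := UniversalToricDescentActDFlatGlue.firstUnitCoeff_le_of_dvd hdvd hg.1 hL.2
  have heq : n = m := le_antisymm hnm hmn
  exact ⟨span_eq_span_of_dvd_of_normProfile hdvd hg.1 (heq ▸ hL.2), heq⟩

/-- **The rational cross-squeeze, ideal form** (the parent node's shape: `I = Ch_Λ(X_E)·R₀⟦T⟧ = (g)`): under the hypotheses of
`span_eq_span_of_rationalWall` with `3^k·L ∈ I`, `I = (L)`. [cite: Washington1997, §7.1] -/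
theorem eq_span_of_rationalWall {I : Ideal (UnrSeries 3)} {g L g' L' : UnrSeries 3} {n m n' m' k : ℕ}
    (hI : I = Ideal.span {g})
    (hg : (∀ i < n, ‖((PowerSeries.coeff i g : unrIntegers 3) : ℂ_[3])‖ < 1) ∧
      ‖((PowerSeries.coeff n g : unrIntegers 3) : ℂ_[3])‖ = 1)
    (hL : (∀ i < m, ‖((PowerSeries.coeff i L : unrIntegers 3) : ℂ_[3])‖ < 1) ∧
      ‖((PowerSeries.coeff m L : unrIntegers 3) : ℂ_[3])‖ = 1)
    (hg' : (∀ i < n', ‖((PowerSeries.coeff i g' : unrIntegers 3) : ℂ_[3])‖ < 1) ∧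
      ‖((PowerSeries.coeff n' g' : unrIntegers 3) : ℂ_[3])‖ = 1)
    (hL' : (∀ i < m', ‖((PowerSeries.coeff i L' : unrIntegers 3) : ℂ_[3])‖ < 1) ∧
      ‖((PowerSeries.coeff m' L' : unrIntegers 3) : ℂ_[3])‖ = 1)
    (htwin : Ideal.span ({g'} : Set (UnrSeries 3)) = Ideal.span {L'}) (hle : n' + m ≤ n + m')
    (hmem : ((3 : ℕ) : UnrSeries 3) ^ k * L ∈ I) :
    I = Ideal.span {L} := by
  subst hI
  exact (span_eq_span_of_rationalWall hg hL hg' hL' htwin hle hmem).1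

end Summit.BirchSwinnertonDyer.BirchSwinnertonDyer.Theorems.UniversalToricDescentRationalCrossSqueeze

end
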